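import Literature.AlgebraicGeometry.Motives.HodgeThetaAnnihilatorSemisimpleTimesAbelian
import Literature.AlgebraicGeometry.Motives.HodgeThetaSubalgebraRankThree
import Literature.AlgebraicGeometry.Motives.HodgeLieWeightOneSl2Triple
import HarnessLib

/-!
# Rational tensors on `V₁ ⊕ V₂` killed by `Θ` are killed by `(Lie Hg(V₁) ⊗ ℂ) ⊕ 0` when `V₁` is of Hodge-group rank
# three and the commutant on `V₂` is abelian (Lombardo 2016 Lemma 3.4 / Moonen–Zarhin 1999 (3.1)–(3.2)(2):
# `Hg(A × B) = Hg(A) × Hg(B)` for `B` of CM type — the Lie step, derived-algebra form, `𝔰𝔩₂`-isotypic case)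

Family `hodge`, layer `Literature/AlgebraicGeometry/Motives` (abstract polarizable `ℚ`-Hodge structures; no geometry).
Written for the cell `pub-hodgecm2` (COR-CM), seat `b27`, count-neutral lane MT-RANK-FIVE-HODGE (the Hodge side of the
rung `dim MT(H¹X) = 5`, non-CM, of the Mumford–Tate rank ladder; sequel of `HodgeThetaSubalgebraRankThree`,
`HodgeLieWeightOneRankFour*`, `Summits/HodgeConjecture/CorCM/MumfordTateRankFive`).  UNCONDITIONAL linear algebra of Hodge
structures, no step towards a summit statement and no use of HC_CM; everything is proved, no definition, no named fact
(D-0026).  It is the `𝔰𝔩₂`-ISOTYPIC twin of the tree's real-multiplication Lie step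
`HodgeStructure.wordDerAt_assemble_eq_zero_of_semisimple_times_abelian` (`Motives/HodgeThetaAnnihilatorSemisimpleTimesAbelian`,
cell `pub-hodge-ring2`), whose presentation calculus (§1–§4 there: `theta_incl_eq`, `proj_theta_eq`,
`bracket_eq_incl_corner_bracket_proj`, `incl_bracket_proj_mem_spanC`) and descent machinery (`annLie`, `mem_spanC_annLie`,
`wordDerAt_eq_zero_of_mem_spanC_annLie`) it reuses BY NAME; the semisimple input on `V₁` is the rank-three `Θ`-subalgebra
theorem `HodgeStructure.hodgeLieC_le_spanC_of_theta_mem` (`Motives/HodgeThetaSubalgebraRankThree`).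

THE PRINTED RESULT.  D. Lombardo, Ann. Inst. Fourier **66** (2016), Lemma 3.4 (p. 1229; Lemma 35 of arXiv:1402.1478):
«Suppose `B` is of CM type and `A_K̄` has no simple factor of type IV. Then we have `H(A × B) ≅ H(A) × H(B)`» (`H^{der}`
surjects onto the semisimple `H(A)`, `H(B)` being a torus); with Moonen–Zarhin, Math. Ann. **315** (1999), §3 (3.1)–(3.2)(2)
(«`X₁` has no factors of Type 4 and `X₂` is of CM-type ⟹ `Hg(X₁ × X₂) = Hg(X₁) × Hg(X₂)`», equivalently the Hodge ring of
`X₁^m × X₂^n` is generated by the factors) this is the input of the tree's product lane (`HodgeTheory/HodgeGroupProductCMFactor`,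
named fact `Lombardo2016_hodgeClassesProductSpan`).  Here `A` is of Moonen–Zarhin Type I(1)/II(1) (`Hg(A) = SL₂`, `SL₁(D)`:
non-CM elliptic curves, abelian surfaces with quaternionic multiplication — `dim_ℚ Lie Hg(H¹A) ≤ 3`, `Lie Hg ⊄ End_Hdg`).

SETTING.  A `ℚ`-space `U` presented as `V₁ ⊕ V₂` (`ι₁, π₁, ι₂, π₂` with `π₁ι₁ = 1`, `π₂ι₂ = 1`, `π₁ι₂ = 0`, `π₂ι₁ = 0`,
`ι₁π₁ + ι₂π₂ = 1`); Hodge structures `H_U`, `H₁`, `H₂` of weight `1` with `ι₁`, `ι₂` mapping Hodge pieces into Hodge pieces;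
on `V₁`: effective, a polarization `ψ₁`, `dim_ℚ Lie Hg(H₁) ≤ 3`, `Lie Hg(H₁) ⊄ End_Hdg(V₁)`; on `V₂`: a family `aF₂` of
Hodge endomorphisms whose commutant in `End_ℚ(V₂)` is commutative (a CM abelian variety).

MAIN RESULTS (all proved):
* §1 **`exists_sum_brackets_of_mem_hodgeLieC_of_rankThree`** — `Lie Hg(H₁) ⊗ ℂ = ℂΘ′ ⊕ ℂE ⊕ ℂF ≅ 𝔰𝔩₂(ℂ)` is PERFECT:
  every element is a sum of three brackets of elements (`E = ½[Θ′,E]`, `F = −½[Θ′,F]`, `Θ′ = α⁻¹[E,F]` from `EF = αP`,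
  `FE = α(1−P)`, `α ≠ 0`, `HodgeLieWeightOneSl2Triple`).
* §2 **`wordDerAt_eq_zero_of_rankThree_times_abelian`** — a RATIONAL coefficient tensor `q` on `U` (letters: slots ×
  a `ℚ`-basis of `U`) killed slice by slice by the matrix of the Hodge operator `Θ_U` is killed by the matrix of
  `ι₁,ℂ ∘ Y ∘ π₁,ℂ` for EVERY `Y ∈ Lie Hg(H₁) ⊗ ℂ`: `(Lie Hg(V₁) ⊗ ℂ) ⊕ 0 ⊆ 𝔞(q)_ℂ`.  PROOF = the template's: the
  rational annihilator algebra `𝔞` of `q` (commuting with `ι₁π₁`, `ι₂π₂`, `ι₁ a π₁` (`a ∈ End_Hdg V₁`), `ι₂ f π₂`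
  (`f ∈ aF₂`), skew for `ψ₁(π₁·, π₁·)`) is bracket-closed with `Θ_U ∈ 𝔞_ℂ`; its elements are block diagonal with
  `V₂`-corners in a commutative algebra, so brackets live on `V₁` (Goursat step); the corner algebra `𝔤 = c₁(𝔞)` is
  bracket-closed, commutes with `End_Hdg(V₁)`, is `ψ₁`-skew and `Θ₁ = c₁(Θ_U) ∈ 𝔤_ℂ`, hence `𝔤_ℂ ⊇ Lie Hg(H₁) ⊗ ℂ`
  (rank-three `Θ`-subalgebra theorem); perfectness of `𝔰𝔩₂` then places `ι₁ Y π₁` in `𝔞_ℂ`.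
* §2 corollary **`wordDerAt_theta_sub_incl_theta_proj_eq_zero_of_rankThree_times_abelian`** — the `V₂`-part
  `Θ_U − ι₁ Θ₁ π₁ (= ι₂ Θ₂ π₂)` of the Hodge operator also kills `q` (the two factors are SEPARATELY balanced).

## References
* [Lombardo2016] D. Lombardo, Ann. Inst. Fourier 66 (2016), Lemma 3.2, Lemma 3.4 (p. 1229) = arXiv:1402.1478 Lemmas 32, 35
  (held `paper:arxiv-1402.1478` p. 8). [cite: Lombardo2016, Lemma 3.4 (p. 1229)]
* [MoonenZarhin1999LowDim] B. Moonen, Yu. Zarhin, Math. Ann. 315 (1999), §2 (2.1)–(2.2) (Types I(1), II(1)), §3 (3.1)–(3.2)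
  (held `paper:arxiv-math_9901113` p. 6). [cite: MoonenZarhin1999LowDim, §3 (3.1)–(3.2)]
* [Deligne1982HodgeCycles] P. Deligne, LNM 900 (1982), I §3 (proof of Prop. 3.4). [cite: Deligne1982HodgeCycles, I §3 Prop. 3.4]
* [Gordon1997] B. B. Gordon, *A survey of the Hodge conjecture for abelian varieties*, App. B of Lewis (1999) =
  arXiv:alg-geom/9709030, §7.3.2 (Murty: type (H)). [cite: Gordon1997, §7.3.2]
* [FultonHarris1991] W. Fulton, J. Harris, GTM 129 (1991), Lecture 11 (§11.1: `𝔰𝔩₂ℂ`). [cite: FultonHarris1991, Lecture 11 (§11.1)]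
-/

noncomputable section

open scoped TensorProduct

namespace Literature.AlgebraicGeometry.Motives

namespace HodgeStructure

open Literature.RepresentationTheory.GeneralLinear

/-! ### §1 `Lie Hg ⊗ ℂ ≅ 𝔰𝔩₂` is perfect in Hodge-group rank three -/

section Perfect

universe u

variable {V : Type u} [AddCommGroup V] [Module ℚ V] [Module.Finite ℚ V] [HodgeTensorFacts.{u, u}] {n : ℤ}

/-- **`Lie Hg(H) ⊗ ℂ` is perfect in rank three.**  For an effective polarizable weight-one `H` with
`dim_ℚ Lie Hg ≤ 3` and `Lie Hg ⊄ End_Hdg`, every `Y ∈ Lie Hg ⊗ ℂ = ℂΘ′ ⊕ ℂE ⊕ ℂF` is a sum of three brackets of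
elements of `Lie Hg ⊗ ℂ`: `[Θ′, E] = 2E`, `[Θ′, F] = −2F`, `[E, F] = αΘ′` with `α ≠ 0` (`E F = α P`, `F E = α (1 − P)`,
`exists_projE_mul_projF_eq_smul`) — `𝔰𝔩₂ = [𝔰𝔩₂, 𝔰𝔩₂]`. [cite: FultonHarris1991, Lecture 11 (§11.1)]
[cite: MoonenZarhin1999LowDim, §2 (2.1)–(2.2)] -/
theorem exists_sum_brackets_of_mem_hodgeLieC_of_rankThree (H : HodgeStructure V n) (ψ : H.Polarization)
    (hn : n = 1) (hH : H.IsEffective) (hne : ¬ H.hodgeLie ≤ Subalgebra.toSubmodule H.endAlg)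
    (h3 : Module.finrank ℚ H.hodgeLie ≤ 3) {Y : Module.End ℂ (ℂ ⊗[ℚ] V)} (hY : Y ∈ H.hodgeLieC) :
    ∃ A B : Fin 3 → Module.End ℂ (ℂ ⊗[ℚ] V), (∀ r, A r ∈ H.hodgeLieC) ∧ (∀ r, B r ∈ H.hodgeLieC) ∧
      Y = ∑ r, (A r * B r - B r * A r) := by
  classical
  obtain ⟨X, hX, hXE⟩ := SetLike.not_le_iff_exists.1 hne
  rw [Subalgebra.mem_toSubmodule] at hXE
  obtain ⟨S, deg, e, hF, hFc⟩ := exists_basis_F_eq_span H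
  haveI : Fintype S := FiniteDimensional.fintypeBasisIndex e
  have hdeg : ∀ σ, deg σ = 0 ∨ deg σ = 1 := fun σ => by
    have h := hH.deg_mem_Icc_of_graded e hF hFc σ
    rw [hn] at h
    omega
  subst hn
  obtain ⟨α, hα, hEF, hFE⟩ := exists_projE_mul_projF_eq_smul H ψ rfl e hF hFc hdeg hX hXE h3
  obtain ⟨c, hc⟩ := exists_coeffs_of_mem_hodgeLieC H rfl e hF hFc hdeg hX hXE h3 hY
  have hΘ'mem₀ := two_smul_gradingEnd_sub_mem_hodgeLieC H e hF hFc
  obtain ⟨hEm, hFm⟩ := projE_mem_hodgeLieC H e hF hFc hdeg (H.baseChange_mem_hodgeLieC hX)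
  have hPP : gradingEnd e deg * gradingEnd e deg = gradingEnd e deg := gradingEnd_mul_gradingEnd_of_deg e hdeg
  set P := gradingEnd e deg with hP
  set Xc := X.baseChange ℂ with hXc
  set E := P * Xc * (1 - P) with hEdef
  set F := (1 - P) * Xc * P with hFdef
  set Θ' : Module.End ℂ (ℂ ⊗[ℚ] V) := (2 : ℂ) • P - 1 with hΘ'
  have hΘ'mem : Θ' ∈ H.hodgeLieC := by
    have e1 : (2 : ℂ) • P - (((1 : ℤ) : ℤ) : ℂ) • (1 : Module.End ℂ (ℂ ⊗[ℚ] V)) = Θ' := by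
      rw [hΘ', Int.cast_one, one_smul]
    rw [← e1]; exact hΘ'mem₀
  have hPE : P * E = E := by rw [hEdef, ← mul_assoc, ← mul_assoc, hPP]
  have hEP : E * P = 0 := by rw [hEdef, mul_assoc (P * Xc) (1 - P) P, sub_mul, one_mul, hPP, sub_self, mul_zero]
  have hPF : P * F = 0 := by
    rw [hFdef, mul_assoc (1 - P) Xc P, ← mul_assoc P (1 - P) (Xc * P), mul_sub, mul_one, hPP, sub_self, zero_mul]
  have hFP : F * P = F := by rw [hFdef, mul_assoc ((1 - P) * Xc) P P, hPP]
  -- the three brackets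
  have br1 : Θ' * E - E * Θ' = (2 : ℂ) • E := by
    rw [hΘ', sub_mul, mul_sub, smul_mul_assoc, mul_smul_comm, one_mul, mul_one, hPE, hEP, smul_zero, zero_sub,
      two_smul]
    abel
  have br2 : F * Θ' - Θ' * F = (2 : ℂ) • F := by
    rw [hΘ', sub_mul, mul_sub, smul_mul_assoc, mul_smul_comm, one_mul, mul_one, hPF, hFP, smul_zero, zero_sub,
      two_smul]
    abel
  have br3 : E * F - F * E = α • Θ' := by
    rw [hEF, hFE, hΘ']
    module
  -- scalar bookkeeping
  have hsm : ∀ (a : ℂ) (Z W : Module.End ℂ (ℂ ⊗[ℚ] V)), (a • Z) * W - W * (a • Z) = a • (Z * W - W * Z) :=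
    fun a Z W => by rw [mul_smul_comm, smul_mul_assoc, smul_sub]
  have e1 : (2 : ℂ)⁻¹ * c 1 * 2 = c 1 := by field_simp
  have e2 : (2 : ℂ)⁻¹ * c 2 * 2 = c 2 := by field_simp
  have e3 : α⁻¹ * c 0 * α = c 0 := by field_simp
  refine ⟨![((2 : ℂ)⁻¹ * c 1) • Θ', ((2 : ℂ)⁻¹ * c 2) • F, (α⁻¹ * c 0) • E], ![E, Θ', F], ?_, ?_, ?_⟩
  · intro r
    fin_cases r
    exacts [Submodule.smul_mem _ _ hΘ'mem, Submodule.smul_mem _ _ hFm, Submodule.smul_mem _ _ hEm]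
  · intro r
    fin_cases r
    exacts [hEm, hΘ'mem, hFm]
  · rw [Fin.sum_univ_three]
    simp only [Matrix.cons_val_zero, Matrix.cons_val_one, Matrix.cons_val]
    rw [hsm, hsm, hsm, br1, br2, br3, smul_smul, smul_smul, smul_smul, e1, e2, e3, hc]
    abel

end Perfect

/-! ### §2 The theorem: `(Lie Hg(V₁) ⊗ ℂ) ⊕ 0` kills every rational tensor killed by `Θ_U` -/

section Main

universe u

variable {U V₁ V₂ : Type u} [AddCommGroup U] [Module ℚ U] [AddCommGroup V₁] [Module ℚ V₁]
  [AddCommGroup V₂] [Module ℚ V₂] [Module.Finite ℚ U] [Module.Finite ℚ V₁] [Module.Finite ℚ V₂]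
  [HodgeTensorFacts.{u, u}] {n : ℤ}
variable {M d m : ℕ}

/-- **Theorem (Lombardo 2016 Lemma 3.4 / Moonen–Zarhin 1999 (3.1)–(3.2)(2), Lie step, in the word model, for a
first factor of Hodge-group rank three).**  Let `U = ι₁V₁ ⊕ ι₂V₂` be a presentation compatible with weight-one Hodge
structures `H_U`, `H₁`, `H₂` (`ι₁`, `ι₂` map `V_i^{p,1-p}` into `U^{p,1-p}`).  On `V₁` let `H₁` be effective with a
polarization `ψ₁`, `dim_ℚ Lie Hg(H₁) ≤ 3` and `Lie Hg(H₁) ⊄ End_Hdg(V₁)` (Moonen–Zarhin Types I(1), II(1): `H¹` of a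
non-CM elliptic curve or of an abelian surface with quaternionic multiplication, and of their powers); on `V₂` let
`aF₂` be Hodge endomorphisms whose commutant in `End_ℚ(V₂)` is commutative (CM).  If a RATIONAL coefficient tensor `q`
on `U` (letters: `Fin m` slots × the `ℚ`-basis `eQ`) is killed, slice by slice, by the matrix of the Hodge operator
`Θ_U`, then it is killed by the matrix of `ι₁,ℂ ∘ Y ∘ π₁,ℂ` for every `Y ∈ Lie Hg(H₁) ⊗ ℂ`:
`(Lie Hg(V₁) ⊗ ℂ) ⊕ 0 ⊆ 𝔞(q)_ℂ` («`H(A × B) ≅ H(A) × H(B)`» for `B` of CM type, here for `A` of Type I(1)/II(1); the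
tree has no algebraic groups, and this is the statement used on tensors).  [cite: Lombardo2016, Lemma 3.4 (p. 1229)]
[cite: MoonenZarhin1999LowDim, §3 (3.1)–(3.2)] [cite: Deligne1982HodgeCycles, I §3 Prop. 3.4] -/
theorem wordDerAt_eq_zero_of_rankThree_times_abelian (hn : n = 1) (HU : HodgeStructure U n)
    (H₁ : HodgeStructure V₁ n) (H₂ : HodgeStructure V₂ n)
    {ι₁ : V₁ →ₗ[ℚ] U} {π₁ : U →ₗ[ℚ] V₁} {ι₂ : V₂ →ₗ[ℚ] U} {π₂ : U →ₗ[ℚ] V₂}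
    (hπι₁ : π₁ ∘ₗ ι₁ = LinearMap.id) (hπι₂ : π₂ ∘ₗ ι₂ = LinearMap.id) (hπ₁ι₂ : π₁ ∘ₗ ι₂ = 0)
    (hπ₂ι₁ : π₂ ∘ₗ ι₁ = 0) (hsum : ι₁ ∘ₗ π₁ + ι₂ ∘ₗ π₂ = LinearMap.id)
    (hι₁F : ∀ p, ∀ x ∈ H₁.piece p (n - p), ι₁.baseChange ℂ x ∈ HU.piece p (n - p))
    (hι₂F : ∀ p, ∀ x ∈ H₂.piece p (n - p), ι₂.baseChange ℂ x ∈ HU.piece p (n - p))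
    (ψ₁ : H₁.Polarization) (hH₁ : H₁.IsEffective)
    (hne : ¬ H₁.hodgeLie ≤ Subalgebra.toSubmodule H₁.endAlg) (h3 : Module.finrank ℚ H₁.hodgeLie ≤ 3)
    {ιF : Type*} (aF₂ : ιF → H₂.endAlg)
    (hF₂ : ∀ Y Y' : Module.End ℚ V₂, (∀ f, Y * (aF₂ f : Module.End ℚ V₂) = (aF₂ f : Module.End ℚ V₂) * Y) →
      (∀ f, Y' * (aF₂ f : Module.End ℚ V₂) = (aF₂ f : Module.End ℚ V₂) * Y') → Y * Y' = Y' * Y)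
    (eQ : Module.Basis (Fin M) ℚ U) (q : (Fin d → Fin m × Fin M) → ℚ)
    {ΘU : Module.End ℂ (ℂ ⊗[ℚ] U)} (hΘU : ∀ p, ∀ x ∈ HU.piece p (n - p), ΘU x = ((2 * p - n : ℤ) : ℂ) • x)
    (hΘq : ∀ u : Fin d → Fin m, wordDerAt ℂ (fun _ : Fin d =>
      LinearMap.toMatrix (Algebra.TensorProduct.basis ℂ eQ) (Algebra.TensorProduct.basis ℂ eQ) ΘU)
      (wordSlice (fun w => algebraMap ℚ ℂ (q w)) u) = 0)
    {Y : Module.End ℂ (ℂ ⊗[ℚ] V₁)} (hY : Y ∈ H₁.hodgeLieC) (u : Fin d → Fin m) :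
    wordDerAt ℂ (fun _ : Fin d =>
      LinearMap.toMatrix (Algebra.TensorProduct.basis ℂ eQ) (Algebra.TensorProduct.basis ℂ eQ)
        (ι₁.baseChange ℂ ∘ₗ Y ∘ₗ π₁.baseChange ℂ))
      (wordSlice (fun w => algebraMap ℚ ℂ (q w)) u) = 0 := by
  classical
  obtain ⟨Θ₁, hΘ₁⟩ := exists_hodgeTheta H₁
  obtain ⟨Θ₂, hΘ₂⟩ := exists_hodgeTheta H₂
  have hΘ₁C : Θ₁ ∈ H₁.hodgeLieC := H₁.mem_hodgeLieC_of_forall_piece hΘ₁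
  have hΘ₂C : Θ₂ ∈ H₂.hodgeLieC := H₂.mem_hodgeLieC_of_forall_piece hΘ₂
  have hsum' : ι₂ ∘ₗ π₂ + ι₁ ∘ₗ π₁ = LinearMap.id := by rw [add_comm]; exact hsum
  -- pointwise slot identities
  have e11 : ∀ v, π₁ (ι₁ v) = v := fun v => by
    rw [← LinearMap.comp_apply (f := π₁), hπι₁, LinearMap.id_apply]
  have e22 : ∀ w, π₂ (ι₂ w) = w := fun w => by
    rw [← LinearMap.comp_apply (f := π₂), hπι₂, LinearMap.id_apply]
  -- `Θ` through the presentation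
  have hΘι₁ := theta_incl_eq HU H₁ hι₁F hΘU hΘ₁
  have hΘι₂ := theta_incl_eq HU H₂ hι₂F hΘU hΘ₂
  have hΘπ₁ := proj_theta_eq HU H₁ H₂ hπι₁ hπ₁ι₂ hsum hι₁F hι₂F hΘU hΘ₁ hΘ₂
  have hΘπ₂ := proj_theta_eq HU H₂ H₁ hπι₂ hπ₂ι₁ hsum' hι₂F hι₁F hΘU hΘ₂ hΘ₁
  -- the commuting family: `ι₁ a π₁` (`a ∈ End_Hdg V₁`), `ι₂ f π₂` (`f ∈ aF₂`), the two projectors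
  set aF : (H₁.endAlg ⊕ ιF) ⊕ (Unit ⊕ Unit) → Module.End ℚ U :=
    Sum.elim (Sum.elim (fun a => ι₁ ∘ₗ (a : Module.End ℚ V₁) ∘ₗ π₁)
      (fun f => ι₂ ∘ₗ (aF₂ f : Module.End ℚ V₂) ∘ₗ π₂))
      (Sum.elim (fun _ => ι₁ ∘ₗ π₁) (fun _ => ι₂ ∘ₗ π₂)) with haF
  set φ : LinearMap.BilinForm ℚ U := ψ₁.form.compl₁₂ π₁ π₁ with hφ
  set 𝔞 : Submodule ℚ (Module.End ℚ U) := annLie φ eQ aF q with h𝔞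
  -- `Θ_U ∈ 𝔞_ℂ`
  have hΘ𝔞 : ΘU ∈ spanC 𝔞 := by
    refine mem_spanC_annLie φ eQ aF q hΘq (fun i => ?_) (fun x y => ?_)
    · apply LinearMap.ext
      intro y
      rcases i with (a | f) | (_ | _)
      · change ΘU ((ι₁ ∘ₗ (a : Module.End ℚ V₁) ∘ₗ π₁).baseChange ℂ y) =
          (ι₁ ∘ₗ (a : Module.End ℚ V₁) ∘ₗ π₁).baseChange ℂ (ΘU y)
        simp only [LinearMap.baseChange_comp, LinearMap.comp_apply]
        rw [hΘι₁, ← Module.End.mul_apply (f := Θ₁), commute_baseChange_of_mem_hodgeLieC H₁ hΘ₁C a,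
          Module.End.mul_apply, hΘπ₁]
      · change ΘU ((ι₂ ∘ₗ (aF₂ f : Module.End ℚ V₂) ∘ₗ π₂).baseChange ℂ y) =
          (ι₂ ∘ₗ (aF₂ f : Module.End ℚ V₂) ∘ₗ π₂).baseChange ℂ (ΘU y)
        simp only [LinearMap.baseChange_comp, LinearMap.comp_apply]
        rw [hΘι₂, ← Module.End.mul_apply (f := Θ₂), commute_baseChange_of_mem_hodgeLieC H₂ hΘ₂C (aF₂ f),
          Module.End.mul_apply, hΘπ₂]
      · change ΘU ((ι₁ ∘ₗ π₁).baseChange ℂ y) = (ι₁ ∘ₗ π₁).baseChange ℂ (ΘU y)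
        simp only [LinearMap.baseChange_comp, LinearMap.comp_apply]
        rw [hΘι₁, hΘπ₁]
      · change ΘU ((ι₂ ∘ₗ π₂).baseChange ℂ y) = (ι₂ ∘ₗ π₂).baseChange ℂ (ΘU y)
        simp only [LinearMap.baseChange_comp, LinearMap.comp_apply]
        rw [hΘι₂, hΘπ₂]
    · rw [hφ, baseChange_compl₁₂_apply, baseChange_compl₁₂_apply, hΘπ₁, hΘπ₁,
        formBaseChange_skew_of_mem_hodgeLieC ψ₁ hΘ₁C, neg_add_cancel]
  -- what membership in `𝔞` gives
  have hmem : ∀ X ∈ 𝔞, (∀ i, X * aF i = aF i * X) ∧ ∀ v w, φ (X v) w + φ v (X w) = 0 :=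
    fun X hX => ((mem_annLie_iff φ eQ aF q X).1 hX).2
  have hP₁ : ∀ X ∈ 𝔞, X * (ι₁ ∘ₗ π₁) = (ι₁ ∘ₗ π₁) * X := fun X hX => (hmem X hX).1 (Sum.inr (Sum.inl ()))
  have hP₂ : ∀ X ∈ 𝔞, X * (ι₂ ∘ₗ π₂) = (ι₂ ∘ₗ π₂) * X := fun X hX => (hmem X hX).1 (Sum.inr (Sum.inr ()))
  have hTa : ∀ X ∈ 𝔞, ∀ a : H₁.endAlg, X * (ι₁ ∘ₗ (a : Module.End ℚ V₁) ∘ₗ π₁) =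
      (ι₁ ∘ₗ (a : Module.End ℚ V₁) ∘ₗ π₁) * X := fun X hX a => (hmem X hX).1 (Sum.inl (Sum.inl a))
  have hTf : ∀ X ∈ 𝔞, ∀ f, X * (ι₂ ∘ₗ (aF₂ f : Module.End ℚ V₂) ∘ₗ π₂) =
      (ι₂ ∘ₗ (aF₂ f : Module.End ℚ V₂) ∘ₗ π₂) * X := fun X hX f => (hmem X hX).1 (Sum.inl (Sum.inr f))
  -- the corners commute with `End_Hdg(V₁)` resp. `aF₂`
  have hc₁comm : ∀ X ∈ 𝔞, ∀ a : H₁.endAlg, (π₁ ∘ₗ X ∘ₗ ι₁) * (a : Module.End ℚ V₁) =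
      (a : Module.End ℚ V₁) * (π₁ ∘ₗ X ∘ₗ ι₁) := by
    intro X hX a
    apply LinearMap.ext
    intro v
    have h := congrArg (fun f : Module.End ℚ U => π₁ (f (ι₁ v))) (hTa X hX a)
    simp only [Module.End.mul_apply, LinearMap.comp_apply, e11] at h
    simp only [Module.End.mul_apply, LinearMap.comp_apply]
    exact h
  have hc₂comm : ∀ X ∈ 𝔞, ∀ f, (π₂ ∘ₗ X ∘ₗ ι₂) * (aF₂ f : Module.End ℚ V₂) =
      (aF₂ f : Module.End ℚ V₂) * (π₂ ∘ₗ X ∘ₗ ι₂) := by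
    intro X hX f
    apply LinearMap.ext
    intro w
    have h := congrArg (fun g : Module.End ℚ U => π₂ (g (ι₂ w))) (hTf X hX f)
    simp only [Module.End.mul_apply, LinearMap.comp_apply, e22] at h
    simp only [Module.End.mul_apply, LinearMap.comp_apply]
    exact h
  have hc₁skew : ∀ X ∈ 𝔞, ∀ v w, ψ₁.form ((π₁ ∘ₗ X ∘ₗ ι₁) v) w + ψ₁.form v ((π₁ ∘ₗ X ∘ₗ ι₁) w) = 0 := by
    intro X hX v w
    have h := (hmem X hX).2 (ι₁ v) (ι₁ w)
    rw [hφ, LinearMap.compl₁₂_apply, LinearMap.compl₁₂_apply, e11, e11] at h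
    simpa only [LinearMap.comp_apply] using h
  -- the Goursat step inside `𝔞`
  have hbr𝔞 : ∀ X ∈ 𝔞, ∀ X' ∈ 𝔞,
      ι₁ ∘ₗ ((π₁ ∘ₗ X ∘ₗ ι₁) * (π₁ ∘ₗ X' ∘ₗ ι₁) - (π₁ ∘ₗ X' ∘ₗ ι₁) * (π₁ ∘ₗ X ∘ₗ ι₁)) ∘ₗ π₁ ∈ 𝔞 := by
    intro X hX X' hX'
    rw [← bracket_eq_incl_corner_bracket_proj hπι₁ hπι₂ hsum (hP₁ X hX) (hP₂ X hX) (hP₁ X' hX') (hP₂ X' hX')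
      (hF₂ _ _ (hc₂comm X hX) (hc₂comm X' hX'))]
    exact commutator_mem_annLie φ eQ aF q hX hX'
  -- the corner algebra `𝔤 = c₁(𝔞)`
  obtain ⟨cLin, hcLin⟩ : ∃ L : Module.End ℚ U →ₗ[ℚ] Module.End ℚ V₁, ∀ X, L X = π₁ ∘ₗ X ∘ₗ ι₁ :=
    ⟨{ toFun := fun X => π₁ ∘ₗ X ∘ₗ ι₁
       map_add' := fun X X' => by rw [LinearMap.add_comp, LinearMap.comp_add]
       map_smul' := fun c X => by rw [LinearMap.smul_comp, LinearMap.comp_smul, RingHom.id_apply] },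
      fun X => rfl⟩
  set 𝔤 : Submodule ℚ (Module.End ℚ V₁) := 𝔞.map cLin with h𝔤
  have h𝔤mem : ∀ {Y}, Y ∈ 𝔤 ↔ ∃ X ∈ 𝔞, π₁ ∘ₗ X ∘ₗ ι₁ = Y := by
    intro Y
    rw [h𝔤, Submodule.mem_map]
    simp only [hcLin]
  have hbr𝔤 : ∀ Y ∈ 𝔤, ∀ Y' ∈ 𝔤, Y * Y' - Y' * Y ∈ 𝔤 := by
    intro Y hY Y' hY'
    obtain ⟨X, hX, rfl⟩ := h𝔤mem.1 hY
    obtain ⟨X', hX', rfl⟩ := h𝔤mem.1 hY'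
    refine h𝔤mem.2 ⟨_, hbr𝔞 X hX X' hX', ?_⟩
    apply LinearMap.ext
    intro v
    simp only [LinearMap.comp_apply, LinearMap.sub_apply, Module.End.mul_apply, e11]
  have hcomm𝔤 : ∀ Y ∈ 𝔤, ∀ a : H₁.endAlg, Y * (a : Module.End ℚ V₁) = (a : Module.End ℚ V₁) * Y := by
    intro Y hY a
    obtain ⟨X, hX, rfl⟩ := h𝔤mem.1 hY
    exact hc₁comm X hX a
  have hskew𝔤 : ∀ Y ∈ 𝔤, ∀ v w, ψ₁.form (Y v) w + ψ₁.form v (Y w) = 0 := by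
    intro Y hY v w
    obtain ⟨X, hX, rfl⟩ := h𝔤mem.1 hY
    exact hc₁skew X hX v w
  have hspanC𝔤 : spanC 𝔤 = Submodule.span ℂ
      ((fun X : Module.End ℚ U => (π₁ ∘ₗ X ∘ₗ ι₁).baseChange ℂ) '' (𝔞 : Set _)) := by
    rw [spanC, h𝔤, Submodule.map_coe, Set.image_image]
    simp only [hcLin]
  -- `Θ₁ = c₁(Θ_U) ∈ 𝔤_ℂ`
  have hcorner : ∀ T ∈ spanC 𝔞, π₁.baseChange ℂ ∘ₗ T ∘ₗ ι₁.baseChange ℂ ∈ spanC 𝔤 := by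
    intro T hT
    induction hT using Submodule.span_induction with
    | mem Z hZ =>
      obtain ⟨X, hX, rfl⟩ := hZ
      rw [← LinearMap.baseChange_comp, ← LinearMap.baseChange_comp]
      exact baseChange_mem_spanC (h𝔤mem.2 ⟨X, hX, rfl⟩)
    | zero => rw [LinearMap.zero_comp, LinearMap.comp_zero]; exact Submodule.zero_mem _
    | add Z Z' _ _ hZ hZ' => rw [LinearMap.add_comp, LinearMap.comp_add]; exact Submodule.add_mem _ hZ hZ'
    | smul c Z _ hZ => rw [LinearMap.smul_comp, LinearMap.comp_smul]; exact Submodule.smul_mem _ c hZ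
  have hΘ₁𝔤 : Θ₁ ∈ spanC 𝔤 := by
    have h : Θ₁ = π₁.baseChange ℂ ∘ₗ ΘU ∘ₗ ι₁.baseChange ℂ := by
      apply LinearMap.ext
      intro x
      rw [LinearMap.comp_apply, LinearMap.comp_apply, hΘι₁, proj_incl_baseChange hπι₁]
    rw [h]
    exact hcorner ΘU hΘ𝔞
  -- the rank-three `Θ`-subalgebra theorem on `V₁`: `𝔤_ℂ ⊇ Lie Hg(H₁) ⊗ ℂ`
  have hZ : H₁.hodgeLieC ≤ spanC 𝔤 :=
    hodgeLieC_le_spanC_of_theta_mem H₁ ψ₁ hn hH₁ hne h3 hbr𝔤 hcomm𝔤 hskew𝔤 hΘ₁ hΘ₁𝔤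
  -- brackets of elements of `𝔤_ℂ`, placed on `V₁`, lie in `𝔞_ℂ`
  have hD : ∀ Z ∈ spanC 𝔤, ∀ Z' ∈ spanC 𝔤,
      ι₁.baseChange ℂ ∘ₗ (Z * Z' - Z' * Z) ∘ₗ π₁.baseChange ℂ ∈ spanC 𝔞 := by
    intro Z hZ' Z' hZ''
    rw [hspanC𝔤] at hZ' hZ''
    exact incl_bracket_proj_mem_spanC 𝔞 hbr𝔞 hZ' hZ''
  -- `𝔰𝔩₂` is perfect
  obtain ⟨A, B, hA, hB, hYsum⟩ := exists_sum_brackets_of_mem_hodgeLieC_of_rankThree H₁ ψ₁ hn hH₁ hne h3 hY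
  have hmemY : ι₁.baseChange ℂ ∘ₗ Y ∘ₗ π₁.baseChange ℂ ∈ spanC 𝔞 := by
    have hs : ι₁.baseChange ℂ ∘ₗ (∑ r, (A r * B r - B r * A r)) ∘ₗ π₁.baseChange ℂ =
        ∑ r, ι₁.baseChange ℂ ∘ₗ (A r * B r - B r * A r) ∘ₗ π₁.baseChange ℂ := by
      apply LinearMap.ext
      intro y
      simp only [LinearMap.comp_apply, LinearMap.sum_apply, map_sum]
    rw [hYsum, hs]
    exact Submodule.sum_mem _ fun r _ => hD _ (hZ (hA r)) _ (hZ (hB r))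
  exact wordDerAt_eq_zero_of_mem_spanC_annLie φ eQ aF q hmemY u

/-- **Corollary: the `V₂`-part of the Hodge operator also kills the tensor.**  With the same data and a Hodge
operator `Θ₁` of `H₁`: the matrix of `Θ_U − ι₁,ℂ Θ₁ π₁,ℂ` (`= ι₂,ℂ Θ₂ π₂,ℂ`, the Hodge operator of `V₂` placed on the
second summand) kills the slices of `q` — the two factors are balanced SEPARATELY (`Θ_U` kills `q` by hypothesis and
`ι₁ Θ₁ π₁` by the theorem, `Θ₁ ∈ Lie Hg(H₁) ⊗ ℂ`). [cite: MoonenZarhin1999LowDim, §3 (3.1)–(3.2)]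
[cite: Deligne1982HodgeCycles, I §3 Prop. 3.4] -/
theorem wordDerAt_theta_sub_incl_theta_proj_eq_zero_of_rankThree_times_abelian (hn : n = 1)
    (HU : HodgeStructure U n) (H₁ : HodgeStructure V₁ n) (H₂ : HodgeStructure V₂ n)
    {ι₁ : V₁ →ₗ[ℚ] U} {π₁ : U →ₗ[ℚ] V₁} {ι₂ : V₂ →ₗ[ℚ] U} {π₂ : U →ₗ[ℚ] V₂}
    (hπι₁ : π₁ ∘ₗ ι₁ = LinearMap.id) (hπι₂ : π₂ ∘ₗ ι₂ = LinearMap.id) (hπ₁ι₂ : π₁ ∘ₗ ι₂ = 0)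
    (hπ₂ι₁ : π₂ ∘ₗ ι₁ = 0) (hsum : ι₁ ∘ₗ π₁ + ι₂ ∘ₗ π₂ = LinearMap.id)
    (hι₁F : ∀ p, ∀ x ∈ H₁.piece p (n - p), ι₁.baseChange ℂ x ∈ HU.piece p (n - p))
    (hι₂F : ∀ p, ∀ x ∈ H₂.piece p (n - p), ι₂.baseChange ℂ x ∈ HU.piece p (n - p))
    (ψ₁ : H₁.Polarization) (hH₁ : H₁.IsEffective)
    (hne : ¬ H₁.hodgeLie ≤ Subalgebra.toSubmodule H₁.endAlg) (h3 : Module.finrank ℚ H₁.hodgeLie ≤ 3)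
    {ιF : Type*} (aF₂ : ιF → H₂.endAlg)
    (hF₂ : ∀ Y Y' : Module.End ℚ V₂, (∀ f, Y * (aF₂ f : Module.End ℚ V₂) = (aF₂ f : Module.End ℚ V₂) * Y) →
      (∀ f, Y' * (aF₂ f : Module.End ℚ V₂) = (aF₂ f : Module.End ℚ V₂) * Y') → Y * Y' = Y' * Y)
    (eQ : Module.Basis (Fin M) ℚ U) (q : (Fin d → Fin m × Fin M) → ℚ)
    {ΘU : Module.End ℂ (ℂ ⊗[ℚ] U)} (hΘU : ∀ p, ∀ x ∈ HU.piece p (n - p), ΘU x = ((2 * p - n : ℤ) : ℂ) • x)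
    (hΘq : ∀ u : Fin d → Fin m, wordDerAt ℂ (fun _ : Fin d =>
      LinearMap.toMatrix (Algebra.TensorProduct.basis ℂ eQ) (Algebra.TensorProduct.basis ℂ eQ) ΘU)
      (wordSlice (fun w => algebraMap ℚ ℂ (q w)) u) = 0)
    {Θ₁ : Module.End ℂ (ℂ ⊗[ℚ] V₁)} (hΘ₁ : ∀ p, ∀ x ∈ H₁.piece p (n - p), Θ₁ x = ((2 * p - n : ℤ) : ℂ) • x)
    (u : Fin d → Fin m) :
    wordDerAt ℂ (fun _ : Fin d =>
      LinearMap.toMatrix (Algebra.TensorProduct.basis ℂ eQ) (Algebra.TensorProduct.basis ℂ eQ)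
        (ΘU - ι₁.baseChange ℂ ∘ₗ Θ₁ ∘ₗ π₁.baseChange ℂ))
      (wordSlice (fun w => algebraMap ℚ ℂ (q w)) u) = 0 := by
  have hΘ₁C : Θ₁ ∈ H₁.hodgeLieC := H₁.mem_hodgeLieC_of_forall_piece hΘ₁
  have h1 := wordDerAt_eq_zero_of_rankThree_times_abelian hn HU H₁ H₂ hπι₁ hπι₂ hπ₁ι₂ hπ₂ι₁ hsum hι₁F hι₂F ψ₁ hH₁
    hne h3 aF₂ hF₂ eQ q hΘU hΘq hΘ₁C u
  have hfam : (fun _ : Fin d => LinearMap.toMatrix (Algebra.TensorProduct.basis ℂ eQ) (Algebra.TensorProduct.basis ℂ eQ)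
        (ΘU - ι₁.baseChange ℂ ∘ₗ Θ₁ ∘ₗ π₁.baseChange ℂ)) =
      (fun _ : Fin d => LinearMap.toMatrix (Algebra.TensorProduct.basis ℂ eQ) (Algebra.TensorProduct.basis ℂ eQ) ΘU) -
        fun _ : Fin d => LinearMap.toMatrix (Algebra.TensorProduct.basis ℂ eQ) (Algebra.TensorProduct.basis ℂ eQ)
          (ι₁.baseChange ℂ ∘ₗ Θ₁ ∘ₗ π₁.baseChange ℂ) := by
    funext t
    rw [map_sub]
    rfl
  rw [hfam, wordDerAt_sub, hΘq u, h1, sub_zero]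

end Main

end HodgeStructure

end Literature.AlgebraicGeometry.Motives

end
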